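/-
Copyright: rh-split cell (screw, bridge) gen 17, 2026-08-27.  Splitting search over kernel-typed
RH-equivalences.  A splitting `A ∧ B ⟹ RH` is CONDITIONAL bookkeeping unless `A` and `B` are both
proved; nothing here bears on the truth of RH.
-/
import Summits.RiemannHypothesis.RiemannHypothesis.Theorems.Splittings.ScrewLatticeSubexp
import HarnessLib

/-!
# The BLASCHKE TOP LAYER — part A (ζ-side: `Θ = sup Re ρ`, `BL(δ)`, `TBL`, structure dichotomy, T-BL typed, conditional row)

Carve A of `ScrewBlaschkeTop.lean` (cell `rh-split`, (screw, bridge) gen 17, card §22): sections 1–4 verbatim.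
Part B (`ScrewWolffNonBlaschke.lean`, ζ-free) certifies that the blind configuration B16′ is non-Blaschke.
See the monolith's module docstring for the dictionary and the paper theorem T-BL.  No `sorry`, no new
axioms, no instances, no notation.  Nothing here bears on the truth of RH.
-/

set_option linter.dupNamespace false

noncomputable section

namespace Summit.RiemannHypothesis.RiemannHypothesis.Theorems.Splittings.ScrewBlaschkeTop

open Literature.NumberTheory.LFunctions
open ZetaZeros.riemannZetaNontrivialZeros
open Summit.RiemannHypothesis.RiemannHypothesis.Theorems.Splittings
open Filter Topology

/-! ## 1. `Θ = sup Re ρ` -/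

/-- `Θ`: the supremum of the real parts of the non-trivial zeros of `ζ`. -/
def supRe : ℝ :=
  sSup ((fun ρ : ℂ ↦ ρ.re) '' ZetaZeros.riemannZetaNontrivialZeros)

/-- The real parts of the non-trivial zeros are bounded above by `1`. -/
theorem bddAbove_re_image :
    BddAbove ((fun ρ : ℂ ↦ ρ.re) '' ZetaZeros.riemannZetaNontrivialZeros) :=
  ⟨1, by rintro _ ⟨ρ, hρ, rfl⟩; exact (re_lt_one hρ).le⟩

/-- There is a non-trivial zero (Hardy), so the set of real parts is non-empty. -/
theorem re_image_nonempty :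
    ((fun ρ : ℂ ↦ ρ.re) '' ZetaZeros.riemannZetaNontrivialZeros).Nonempty := by
  obtain ⟨ρ, hρ, -⟩ := ScrewLatticeSup.exists_zero_on_critical_line
  exact ⟨_, ρ, hρ, rfl⟩

/-- `Re ρ ≤ Θ` for every non-trivial zero. -/
theorem re_le_supRe {ρ : ℂ} (hρ : ρ ∈ ZetaZeros.riemannZetaNontrivialZeros) : ρ.re ≤ supRe :=
  le_csSup bddAbove_re_image ⟨ρ, hρ, rfl⟩

/-- `Θ ≤ b` as soon as `Re ρ ≤ b` for every non-trivial zero. -/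
theorem supRe_le {b : ℝ}
    (hb : ∀ ρ : ℂ, ρ ∈ ZetaZeros.riemannZetaNontrivialZeros → ρ.re ≤ b) : supRe ≤ b :=
  csSup_le re_image_nonempty (by rintro _ ⟨ρ, hρ, rfl⟩; exact hb ρ hρ)

/-- Below `Θ` there is always a zero: `b < Θ ⟹ ∃ ρ, b < Re ρ`. -/
theorem exists_lt_re_of_lt_supRe {b : ℝ} (hb : b < supRe) :
    ∃ ρ : ℂ, ρ ∈ ZetaZeros.riemannZetaNontrivialZeros ∧ b < ρ.re := by
  obtain ⟨_, ⟨ρ, hρ, rfl⟩, hlt⟩ := exists_lt_of_lt_csSup re_image_nonempty hb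
  exact ⟨ρ, hρ, hlt⟩

/-- The symmetry `ρ ↦ 1 - ρ̄`: `1 - Re ρ ≤ Θ`. -/
theorem one_sub_re_le_supRe {ρ : ℂ} (hρ : ρ ∈ ZetaZeros.riemannZetaNontrivialZeros) :
    1 - ρ.re ≤ supRe := by
  have h := re_le_supRe (one_sub_conj_mem hρ)
  simpa only [Complex.sub_re, Complex.one_re, Complex.conj_re] using h

/-- `1/2 ≤ Θ`. -/
theorem half_le_supRe : 1 / 2 ≤ supRe := by
  obtain ⟨ρ, hρ, hre⟩ := ScrewLatticeSup.exists_zero_on_critical_line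
  have h := re_le_supRe hρ
  rwa [hre] at h

/-- `Θ ≤ 1`. -/
theorem supRe_le_one : supRe ≤ 1 := supRe_le fun _ hρ ↦ (re_lt_one hρ).le

/-- **`RH ⟺ Θ = 1/2`.** -/
theorem rh_iff_supRe_eq_half : RiemannHypothesis ↔ supRe = 1 / 2 := by
  constructor
  · intro hRH
    refine le_antisymm (supRe_le fun ρ hρ ↦ ?_) half_le_supRe
    have hq : QuasiRiemannHypothesis (1 / 2) := quasiRiemannHypothesis_one_half_iff_holds.2 hRH
    by_contra hlt
    push Not at hlt
    exact hq ρ (zeta_eq_zero hρ) hlt (re_lt_one hρ)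
  · intro heq
    refine quasiRiemannHypothesis_one_half_iff_holds.1 fun s hs h1 h2 ↦ ?_
    have hs' : s ∈ ZetaZeros.riemannZetaNontrivialZeros := mem_of_re_pos hs (by linarith)
    have h3 := re_le_supRe hs'
    linarith

/-- **`MaxRe ⟺ Θ is attained`** (`MaxRe` verbatim as in `ScrewLatticeSup` / `ScrewLatticeSubexp`). -/
theorem maxRe_iff_exists_re_eq_supRe :
    (∃ ρ₀ : ℂ, ρ₀ ∈ ZetaZeros.riemannZetaNontrivialZeros ∧
        ∀ ρ : ℂ, ρ ∈ ZetaZeros.riemannZetaNontrivialZeros → ρ.re ≤ ρ₀.re) ↔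
      ∃ ρ₀ : ℂ, ρ₀ ∈ ZetaZeros.riemannZetaNontrivialZeros ∧ ρ₀.re = supRe := by
  constructor
  · rintro ⟨ρ₀, h₀, hmax⟩
    exact ⟨ρ₀, h₀, le_antisymm (re_le_supRe h₀) (supRe_le hmax)⟩
  · rintro ⟨ρ₀, h₀, heq⟩
    exact ⟨ρ₀, h₀, fun ρ hρ ↦ heq ▸ re_le_supRe hρ⟩

/-- `¬MaxRe ⟺ every zero lies strictly below Θ`. -/
theorem not_maxRe_iff_forall_re_lt :
    (¬ ∃ ρ₀ : ℂ, ρ₀ ∈ ZetaZeros.riemannZetaNontrivialZeros ∧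
        ∀ ρ : ℂ, ρ ∈ ZetaZeros.riemannZetaNontrivialZeros → ρ.re ≤ ρ₀.re) ↔
      ∀ ρ : ℂ, ρ ∈ ZetaZeros.riemannZetaNontrivialZeros → ρ.re < supRe := by
  rw [maxRe_iff_exists_re_eq_supRe]
  push Not
  constructor
  · intro h ρ hρ
    exact lt_of_le_of_ne (re_le_supRe hρ) (h ρ hρ)
  · intro h ρ hρ
    exact (h ρ hρ).ne

/-! ## 2. The Blaschke top layer `BL(δ)` and `TBL` -/

/-- `BL(δ)` («BLASCHKE TOP LAYER» of width `δ`): the zeros with `Θ - δ < Re ρ < Θ` have summable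
depths `Θ - Re ρ`.  `h`-free and `γ`-free.  Open; RH-implied (`blaschkeTop_of_rh`). -/
@[conjecture] def BlaschkeTop (δ : ℝ) : Prop :=
  Summable fun ρ : ZetaZeros.riemannZetaNontrivialZeros ↦
    if supRe - δ < (ρ : ℂ).re ∧ (ρ : ℂ).re < supRe then supRe - (ρ : ℂ).re else 0

/-- `TBL` := `∃ δ > 0, BL(δ)`: SOME top band is Blaschke.  Open; RH-implied (`topBlaschke_of_rh`). -/
@[conjecture] def TopBlaschke : Prop := ∃ δ : ℝ, 0 < δ ∧ BlaschkeTop δ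

/-- The summand of `BL(δ)`. -/
def blTerm (δ : ℝ) (ρ : ZetaZeros.riemannZetaNontrivialZeros) : ℝ :=
  if supRe - δ < (ρ : ℂ).re ∧ (ρ : ℂ).re < supRe then supRe - (ρ : ℂ).re else 0

/-- `BL(δ)` is summability of `blTerm δ` (definitional). -/
theorem blaschkeTop_iff {δ : ℝ} : BlaschkeTop δ ↔ Summable (blTerm δ) := Iff.rfl

/-- The summand is non-negative. -/
theorem blTerm_nonneg (δ : ℝ) (ρ : ZetaZeros.riemannZetaNontrivialZeros) : 0 ≤ blTerm δ ρ := by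
  unfold blTerm
  split_ifs with h
  · linarith [h.2]
  · exact le_rfl

/-- The summand is monotone in the width. -/
theorem blTerm_le_blTerm {δ δ' : ℝ} (h : δ' ≤ δ) (ρ : ZetaZeros.riemannZetaNontrivialZeros) :
    blTerm δ' ρ ≤ blTerm δ ρ := by
  unfold blTerm
  by_cases h1 : supRe - δ' < (ρ : ℂ).re ∧ (ρ : ℂ).re < supRe
  · have h2 : supRe - δ < (ρ : ℂ).re ∧ (ρ : ℂ).re < supRe := ⟨by linarith [h1.1], h1.2⟩
    rw [if_pos h1, if_pos h2]
  · rw [if_neg h1]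
    split_ifs with h2
    · linarith [h2.2]
    · exact le_rfl

/-- `BL` is monotone: a narrower band is easier (`δ' ≤ δ`: `BL(δ) ⟹ BL(δ')`). -/
theorem blaschkeTop_mono {δ δ' : ℝ} (h : δ' ≤ δ) (hδ : BlaschkeTop δ) : BlaschkeTop δ' :=
  Summable.of_nonneg_of_le (blTerm_nonneg δ') (blTerm_le_blTerm h) hδ

/-- A band containing only finitely many zeros is Blaschke. -/
theorem blaschkeTop_of_finite {δ : ℝ}
    (hfin : {ρ : ℂ | ρ ∈ ZetaZeros.riemannZetaNontrivialZeros ∧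
      (supRe - δ < ρ.re ∧ ρ.re < supRe)}.Finite) : BlaschkeTop δ := by
  set T : Set ZetaZeros.riemannZetaNontrivialZeros :=
    {ρ | supRe - δ < (ρ : ℂ).re ∧ (ρ : ℂ).re < supRe} with hT
  have hTfin : T.Finite := by
    have himg : ((fun ρ : ZetaZeros.riemannZetaNontrivialZeros ↦ (ρ : ℂ)) '' T).Finite := by
      refine hfin.subset ?_
      rintro _ ⟨ρ, hρ, rfl⟩
      exact ⟨ρ.2, hρ⟩
    exact himg.of_finite_image Subtype.val_injective.injOn
  unfold BlaschkeTop
  refine summable_of_ne_finset_zero (s := hTfin.toFinset) fun ρ hρ ↦ ?_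
  rw [Set.Finite.mem_toFinset] at hρ
  exact if_neg hρ

/-- Every zero satisfies `1 - Θ ≤ Re ρ`; so if `Θ = 1/2` every top band is EMPTY. -/
theorem band_eq_empty_of_supRe_eq_half (h : supRe = 1 / 2) (δ : ℝ) :
    {ρ : ℂ | ρ ∈ ZetaZeros.riemannZetaNontrivialZeros ∧ (supRe - δ < ρ.re ∧ ρ.re < supRe)} = ∅ := by
  ext ρ
  simp only [Set.mem_setOf_eq, Set.mem_empty_iff_false, iff_false, not_and, not_lt]
  intro hρ _
  have h1 := one_sub_re_le_supRe hρ
  linarith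

/-- `Θ = 1/2 ⟹ BL(δ)` for every `δ`. -/
theorem blaschkeTop_of_supRe_eq_half (h : supRe = 1 / 2) (δ : ℝ) : BlaschkeTop δ :=
  blaschkeTop_of_finite (by rw [band_eq_empty_of_supRe_eq_half h δ]; exact Set.finite_empty)

/-- **`RH ⟹ BL(δ)`** for every `δ` (RH-implied leg, vacuous band). -/
theorem blaschkeTop_of_rh (hRH : RiemannHypothesis) (δ : ℝ) : BlaschkeTop δ :=
  blaschkeTop_of_supRe_eq_half (rh_iff_supRe_eq_half.1 hRH) δ

/-- **`RH ⟹ TBL`.** -/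
theorem topBlaschke_of_rh (hRH : RiemannHypothesis) : TopBlaschke :=
  ⟨1, one_pos, blaschkeTop_of_rh hRH 1⟩

/-- For `δ ≤ Θ - 1/2` the top band lies off the critical line. -/
theorem band_subset_offLine {δ : ℝ} (hδ : δ ≤ supRe - 1 / 2) :
    {ρ : ℂ | ρ ∈ ZetaZeros.riemannZetaNontrivialZeros ∧ (supRe - δ < ρ.re ∧ ρ.re < supRe)} ⊆
      {ρ : ℂ | ρ ∈ ZetaZeros.riemannZetaNontrivialZeros ∧ ρ.re ≠ 1 / 2} := by
  rintro ρ ⟨hρ, hlo, -⟩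
  exact ⟨hρ, by intro heq; linarith⟩

/-- RH-free: **finitely many zeros off the critical line ⟹ TBL.** -/
theorem topBlaschke_of_finite_offLine
    (hfin : {ρ : ℂ | ρ ∈ ZetaZeros.riemannZetaNontrivialZeros ∧ ρ.re ≠ 1 / 2}.Finite) :
    TopBlaschke := by
  by_cases h : supRe = 1 / 2
  · exact ⟨1, one_pos, blaschkeTop_of_supRe_eq_half h 1⟩
  · have hδ : 0 < supRe - 1 / 2 := by
      rcases half_le_supRe.lt_or_eq with h1 | h1
      · linarith
      · exact absurd h1.symm h
    exact ⟨supRe - 1 / 2, hδ, blaschkeTop_of_finite (hfin.subset (band_subset_offLine le_rfl))⟩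

/-- RH-free: **FOZ ⟹ TBL** (`Theses.RuelleBand.CofiniteCriticalLine`: finitely many zeros of `ζ` in
the open strip off the line). -/
theorem topBlaschke_of_foz (hfoz : Theses.RuelleBand.CofiniteCriticalLine) : TopBlaschke :=
  topBlaschke_of_finite_offLine (hfoz.subset (by
    rintro ρ ⟨hρ, hne⟩
    exact ⟨zeta_eq_zero hρ, re_pos hρ, re_lt_one hρ, hne⟩))

/-- RH-free: **the eventual strip ⟹ TBL** (`ES` in the form used by
`ScrewLatticeContinuation.countableClosure_of_eventualStrip`: for every `η > 0` only finitely many zeros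
have `|Re ρ - 1/2| ≥ η`). -/
theorem topBlaschke_of_eventualStrip
    (hES : ∀ η : ℝ, 0 < η →
      {ρ : ℂ | ρ ∈ ZetaZeros.riemannZetaNontrivialZeros ∧ η ≤ |ρ.re - 1 / 2|}.Finite) :
    TopBlaschke := by
  by_cases h : supRe = 1 / 2
  · exact ⟨1, one_pos, blaschkeTop_of_supRe_eq_half h 1⟩
  · have hδ : 0 < supRe - 1 / 2 := by
      rcases half_le_supRe.lt_or_eq with h1 | h1
      · linarith
      · exact absurd h1.symm h
    refine ⟨(supRe - 1 / 2) / 2, by positivity, blaschkeTop_of_finite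
      ((hES ((supRe - 1 / 2) / 2) (by positivity)).subset ?_)⟩
    rintro ρ ⟨hρ, hlo, -⟩
    refine ⟨hρ, ?_⟩
    have h1 : (supRe - 1 / 2) / 2 < ρ.re - 1 / 2 := by linarith
    rw [abs_of_pos (by linarith)]
    exact h1.le

/-! ## 3. RH-free structure of the residue under `CEIL(h)` -/

/-- If every zero lies strictly below `Θ`, every top band `{Θ - δ < Re ρ}` is infinite. -/
theorem infinite_band_of_forall_re_lt
    (hlt : ∀ ρ : ℂ, ρ ∈ ZetaZeros.riemannZetaNontrivialZeros → ρ.re < supRe) {δ : ℝ} (hδ : 0 < δ) :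
    {ρ : ℂ | ρ ∈ ZetaZeros.riemannZetaNontrivialZeros ∧ supRe - δ < ρ.re}.Infinite := by
  by_contra hfin
  rw [Set.not_infinite] at hfin
  rcases hfin.toFinset.eq_empty_or_nonempty with hS | hS
  · have h1 : supRe ≤ supRe - δ := supRe_le fun ρ hρ ↦ by
      by_contra hgt
      push Not at hgt
      have h2 : ρ ∈ hfin.toFinset := hfin.mem_toFinset.2 ⟨hρ, hgt⟩
      rw [hS] at h2
      simp at h2
    linarith
  · obtain ⟨ρs, hρs, hmax⟩ := hfin.toFinset.exists_max_image (fun ρ : ℂ ↦ ρ.re) hS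
    have hρs' := hfin.mem_toFinset.1 hρs
    have hlt' := hlt ρs hρs'.1
    have h1 : supRe ≤ max ρs.re (supRe - δ) := supRe_le fun ρ hρ ↦ by
      by_cases hgt : supRe - δ < ρ.re
      · exact (hmax ρ (hfin.mem_toFinset.2 ⟨hρ, hgt⟩)).trans (le_max_left _ _)
      · push Not at hgt
        exact hgt.trans (le_max_right _ _)
    have h2 : max ρs.re (supRe - δ) < supRe := max_lt hlt' (by linarith)
    linarith

/-- **STRUCTURE OF THE RESIDUE** (`h > 0`, RH-free): under `CEIL(h)` either RH holds, or `Θ > 1/2` is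
NOT attained and every top band `{Θ - δ < Re ρ}` contains infinitely many zeros (the off-line zeros
crowd below their supremal abscissa).  From `ScrewLatticeSubexp.latticeCeiling_dichotomy_maxRe`. -/
theorem latticeCeiling_dichotomy_top {h : ℝ} (hh : 0 < h)
    (hceil : ∀ ε : ℝ, 0 < ε → ∃ K : ℝ, ∀ k : ℕ, |zetaScrew (k * h)| ≤ K * Real.exp (ε * k)) :
    RiemannHypothesis ∨
      (1 / 2 < supRe ∧
        (∀ ρ : ℂ, ρ ∈ ZetaZeros.riemannZetaNontrivialZeros → ρ.re < supRe) ∧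
        ∀ δ : ℝ, 0 < δ →
          {ρ : ℂ | ρ ∈ ZetaZeros.riemannZetaNontrivialZeros ∧ supRe - δ < ρ.re}.Infinite) := by
  rcases ScrewLatticeSubexp.latticeCeiling_dichotomy_maxRe hh hceil with hRH | hnot
  · exact Or.inl hRH
  · right
    have hlt := not_maxRe_iff_forall_re_lt.1 hnot
    obtain ⟨ρ₁, hρ₁, hre⟩ := ScrewLatticeSup.exists_zero_on_critical_line
    have h1 := hlt ρ₁ hρ₁
    rw [hre] at h1
    exact ⟨h1, hlt, fun δ hδ ↦ infinite_band_of_forall_re_lt hlt hδ⟩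

/-! ## 4. The paper theorem T-BL(h), typed; its RH-free reading; the conditional row -/

/-- **T-BL(h)** («BLASCHKE TRANSPARENCY», a PAPER theorem — Khavinson–Ross–Shapiro bounded type of
Blaschke Borel series + Lusin–Privalov; NOT proved in this kernel, recorded as a `Prop` so that the row
below is proved modulo exactly this statement; tagged `@[conjecture]` = kernel-open): `CEIL(h) ∧ TBL ⟹ RH`. -/
@[conjecture] def BlaschkeTransparency (h : ℝ) : Prop :=
  (∀ ε : ℝ, 0 < ε → ∃ K : ℝ, ∀ k : ℕ, |zetaScrew (k * h)| ≤ K * Real.exp (ε * k)) →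
    TopBlaschke → RiemannHypothesis

/-- The RH-free reading of T-BL(h): **NON-BLASCHKE RESIDUE** — under `CEIL(h)` and `¬RH` NO top band
is Blaschke (the zeros crowd below `Θ` with divergent total depth in every band). -/
@[conjecture] def NonBlaschkeResidue (h : ℝ) : Prop :=
  (∀ ε : ℝ, 0 < ε → ∃ K : ℝ, ∀ k : ℕ, |zetaScrew (k * h)| ≤ K * Real.exp (ε * k)) →
    ¬ RiemannHypothesis → ∀ δ : ℝ, 0 < δ → ¬ BlaschkeTop δ

/-- The two readings are the same statement (pure logic). -/
theorem nonBlaschkeResidue_iff (h : ℝ) : NonBlaschkeResidue h ↔ BlaschkeTransparency h := by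
  unfold NonBlaschkeResidue BlaschkeTransparency TopBlaschke
  constructor
  · rintro H hceil ⟨δ, hδ, hbl⟩
    by_contra hn
    exact H hceil hn δ hδ hbl
  · intro H hceil hn δ hδ hbl
    exact hn (H hceil ⟨δ, hδ, hbl⟩)

/-- **CONDITIONAL ROW** (`h > 0`): `T-BL(h) ⟹ (CEIL(h) ∧ TBL ⟺ RH)`.  The `⟸` half is unconditional
(`CEIL` from the gen-14 row, `TBL` from `topBlaschke_of_rh`). -/
theorem latticeCeiling_and_topBlaschke_iff_rh_of {h : ℝ} (hh : 0 < h)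
    (hT : BlaschkeTransparency h) :
    ((∀ ε : ℝ, 0 < ε → ∃ K : ℝ, ∀ k : ℕ, |zetaScrew (k * h)| ≤ K * Real.exp (ε * k)) ∧
      TopBlaschke) ↔ RiemannHypothesis :=
  ⟨fun hab ↦ hT hab.1 hab.2, fun hRH ↦
    ⟨((ScrewLatticeSubexp.maxRe_and_latticeCeiling_iff_rh hh).2 hRH).2, topBlaschke_of_rh hRH⟩⟩

/-- **CONDITIONAL ROW, disjunctive form** (`h > 0`): `T-BL(h) ⟹ (CEIL(h) ∧ (MaxRe ∨ TBL) ⟺ RH)`; the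
`MaxRe` branch is the unconditional gen-14 row `ScrewLatticeSubexp.maxRe_and_latticeCeiling_iff_rh`. -/
theorem latticeCeiling_and_maxRe_or_topBlaschke_iff_rh_of {h : ℝ} (hh : 0 < h)
    (hT : BlaschkeTransparency h) :
    ((∀ ε : ℝ, 0 < ε → ∃ K : ℝ, ∀ k : ℕ, |zetaScrew (k * h)| ≤ K * Real.exp (ε * k)) ∧
      ((∃ ρ₀ : ℂ, ρ₀ ∈ ZetaZeros.riemannZetaNontrivialZeros ∧
          ∀ ρ : ℂ, ρ ∈ ZetaZeros.riemannZetaNontrivialZeros → ρ.re ≤ ρ₀.re) ∨ TopBlaschke)) ↔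
      RiemannHypothesis := by
  refine ⟨fun hab ↦ ?_, fun hRH ↦ ⟨((ScrewLatticeSubexp.maxRe_and_latticeCeiling_iff_rh hh).2 hRH).2,
    Or.inl (ScrewLatticeSup.maxRe_of_rh hRH)⟩⟩
  rcases hab.2 with hmax | htbl
  · exact (ScrewLatticeSubexp.maxRe_and_latticeCeiling_iff_rh hh).1 ⟨hmax, hab.1⟩
  · exact hT hab.1 htbl


end Summit.RiemannHypothesis.RiemannHypothesis.Theorems.Splittings.ScrewBlaschkeTop

end
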